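import Mathlib
import Literature.NumberTheory.Transcendental.KZSemiCanonicalReductionDimOne
import Summits.KontsevichZagierPeriods.KontsevichZagierPeriods.Theorems.InverseLandauTateFamilyKernelCurvesStubAnglePartToArcs

/-!
# `TateLifting` (stmt-KontsevichZagierPeriods-9129), line `Sketch` — stub `stub_dimOneUnitChart`

UNIT CHART OF AN INTERVAL PIECE. A KZ-rational one-dimensional representation
`ρ = [(u,v), p₀/q₀]` (`u < v` real algebraic, `p₀, q₀ ∈ ℚ[x₀]`, `q₀ ≠ 0` on the OPEN interval,
`p₀/q₀ ∈ L¹(u,v)` by `ρ.integrableOn`) differs by relations from a representation in UNIT FORM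
`ρ' = [(0,1), p/q]` with `p, q ∈ ℝ[x]` having real-algebraic coefficients and `q ≠ 0` on the
CLOSED interval `[0,1]`.

Proof.
* Read `p₀, q₀` as univariate polynomials over the field `K = ℚ̄ ∩ ℝ = algebraicClosure ℚ ℝ` of
  real algebraic numbers (`DimOne.uc_exists_reading`); all the algebra below happens in `K[X]`,
  so that every real polynomial produced has real-algebraic coefficients
  (`DimOne.uc_isAlgebraic_coeff`).
* If `p₀ = 0` take `P = 0`, `Q = 1`. Otherwise `q₀ ≠ 0`, and integrability of `p₀/q₀` on `(u,v)`
  forces NO INTEGRABLE POLE at the end points: `ord_a q₀ ≤ ord_a p₀` for `a = u, v`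
  (`KZ.rootMultiplicity_le_of_integrableOn`, transported along `K ↪ ℝ` by
  `Polynomial.eq_rootMultiplicity_map`); hence `D = (X − u)^{ord_u q₀} (X − v)^{ord_v q₀}` divides
  `p₀` and `q₀` (coprimality of `X − u`, `X − v`), `p₀ = D P`, `q₀ = D Q` with `Q(u) Q(v) ≠ 0`
  (maximality of the root multiplicity, `DimOne.uc_cancel`), `Q ≠ 0` on `[u,v]` and
  `p₀/q₀ = P/Q` point-wise on `(u,v)` (`DimOne.uc_exists_cancelled`).
* The affine chart `s = (t − u)/(v − u)` of `ℝ¹` is ONE change of variables (rule 2): with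
  `p = (v−u) · P(u + (v−u)X)`, `q = Q(u + (v−u)X)` (so `q ≠ 0` on `[0,1]`), the honest
  representation `ρ' = [(0,1), p/q]` satisfies `[ρ] − [ρ'] ∈ changeOfVariablesRel ⊆ relations`
  (derivative `(1/(v−u)) • id`, `|det| = 1/(v−u)`, pull-back identity
  `P(t)/Q(t) = (v−u) P(t)/Q(t) · 1/(v−u)`; the chart API `ap_*` of the `AnglePartToArcs` stub),
  `DimOne.uc_chart`.

References: J. Viu-Sos, *A semi-canonical reduction for periods of Kontsevich–Zagier*, Int. J.
Number Theory 17 (2021), §2.3 (first paragraph: no pole to separate in dimension one);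
M. Kontsevich, D. Zagier, *Periods* (2001), §1.2, rules (1), (2).
-/

noncomputable section

open MeasureTheory Set Polynomial
open Literature.NumberTheory.Transcendental
open Literature.ModelTheory.ExponentialFields (IsSemialgebraic isSemialgebraic_univ)

namespace Summit.KontsevichZagierPeriods.InverseLandau

namespace DimOne

/-! ### Algebra: cancelling the end-point factors -/

/-- **Cancellation of the end-point factors.** Over a field, if `Q ≠ 0`, `u ≠ v`,
`a = ord_u Q`, `b = ord_v Q` and `(X − u)^a`, `(X − v)^b` divide `P`, then
`D = (X − u)^a (X − v)^b` divides `P` and `Q` (coprime factors), `P = D P₁`, `Q = D Q₁`, and `Q₁`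
vanishes neither at `u` nor at `v` (otherwise `(X − u)^{a+1} ∣ Q`, contradicting the maximality of
the root multiplicity). [folklore] -/
theorem uc_cancel {K : Type*} [Field K] {P Q : K[X]} (hQ : Q ≠ 0) {u v : K} (huv : u ≠ v)
    {a b : ℕ} (ha : Q.rootMultiplicity u = a) (hb : Q.rootMultiplicity v = b)
    (hPu : (X - C u) ^ a ∣ P) (hPv : (X - C v) ^ b ∣ P) :
    ∃ D P₁ Q₁ : K[X], P = D * P₁ ∧ Q = D * Q₁ ∧ Q₁.eval u ≠ 0 ∧ Q₁.eval v ≠ 0 := by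
  have hcop : IsCoprime ((X - C u) ^ a) ((X - C v) ^ b) :=
    (isCoprime_X_sub_C_of_isUnit_sub (sub_ne_zero.2 huv).isUnit).pow
  obtain ⟨P₁, hP₁⟩ := hcop.mul_dvd hPu hPv
  obtain ⟨Q₁, hQ₁⟩ : (X - C u) ^ a * (X - C v) ^ b ∣ Q :=
    hcop.mul_dvd (by rw [← ha]; exact pow_rootMultiplicity_dvd Q u)
      (by rw [← hb]; exact pow_rootMultiplicity_dvd Q v)
  refine ⟨_, P₁, Q₁, hP₁, hQ₁, fun h => ?_, fun h => ?_⟩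
  · have h1 : (X - C u) ^ (a + 1) ∣ Q := by
      rw [pow_succ, hQ₁]
      exact mul_dvd_mul (dvd_mul_right _ _) (dvd_iff_isRoot.2 h)
    have h2 := (le_rootMultiplicity_iff hQ).2 h1
    omega
  · have h1 : (X - C v) ^ (b + 1) ∣ Q := by
      rw [pow_succ, hQ₁]
      exact mul_dvd_mul (dvd_mul_left _ _) (dvd_iff_isRoot.2 h)
    have h2 := (le_rootMultiplicity_iff hQ).2 h1
    omega

/-! ### Reading a KZ-rational integrand of dimension one over `K = ℚ̄ ∩ ℝ`

Below `K` is `algebraicClosure ℚ ℝ`, the intermediate field of real algebraic numbers, and the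
real polynomial attached to `f ∈ K[X]` is `f.map (algebraMap K ℝ)`. -/

/-- Univariate reading of a polynomial in the single variable `x₀` with rational coefficients.
[folklore] -/
theorem uc_exists_aeval_eq (q : MvPolynomial (Fin 1) ℚ) :
    ∃ p : ℚ[X], ∀ t : ℝ, MvPolynomial.aeval (fun _ : Fin 1 => t) q = Polynomial.aeval t p := by
  refine ⟨MvPolynomial.aeval (fun _ : Fin 1 => (X : ℚ[X])) q, fun t => ?_⟩
  rw [← AlgHom.comp_apply, MvPolynomial.comp_aeval]
  simp

/-- Evaluating the real polynomial attached to a rational one through `ℚ → K → ℝ`. [folklore] -/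
theorem uc_eval_map_map (p : ℚ[X]) (t : ℝ) :
    ((p.map (algebraMap ℚ (algebraicClosure ℚ ℝ))).map (algebraMap _ ℝ)).eval t =
      Polynomial.aeval t p := by
  rw [Polynomial.map_map, ← IsScalarTower.algebraMap_eq ℚ (algebraicClosure ℚ ℝ) ℝ,
    Polynomial.eval_map, Polynomial.aeval_def]

/-- The real polynomial attached to a polynomial over `K` has real-algebraic coefficients.
[folklore] -/
theorem uc_isAlgebraic_coeff (f : (algebraicClosure ℚ ℝ)[X]) (n : ℕ) :
    IsAlgebraic ℚ ((f.map (algebraMap _ ℝ)).coeff n) := by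
  rw [Polynomial.coeff_map]
  exact mem_algebraicClosure_iff.1 (f.coeff n).2

/-- Evaluating the real polynomial attached to `Q ∈ K[X]` at a point of `K`. [folklore] -/
theorem uc_eval_map_coe (Q : (algebraicClosure ℚ ℝ)[X]) (a : algebraicClosure ℚ ℝ) :
    (Q.map (algebraMap _ ℝ)).eval (a : ℝ) = algebraMap _ ℝ (Q.eval a) := by
  rw [Polynomial.eval_map]
  exact Polynomial.eval₂_at_apply (algebraMap _ ℝ) a

/-- **Reading over `K`.** A KZ-rational integrand of dimension one is `P(x₀)/Q(x₀)` on the domain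
for polynomials `P, Q` over `K` (indeed over `ℚ`), `Q(x₀) ≠ 0` on the domain. [folklore] -/
theorem uc_exists_reading (ρ : KZ.IntegralRep 1) (hrat : ρ.IsRational) :
    ∃ P Q : (algebraicClosure ℚ ℝ)[X], (∀ x ∈ ρ.domain, (Q.map (algebraMap _ ℝ)).eval (x 0) ≠ 0) ∧
      EqOn ρ.integrand
        (fun x => (P.map (algebraMap _ ℝ)).eval (x 0) / (Q.map (algebraMap _ ℝ)).eval (x 0))
        ρ.domain := by
  obtain ⟨p, q, hq, hpq⟩ := hrat
  obtain ⟨p₁, hp₁⟩ := uc_exists_aeval_eq p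
  obtain ⟨q₁, hq₁⟩ := uc_exists_aeval_eq q
  refine ⟨p₁.map (algebraMap ℚ _), q₁.map (algebraMap ℚ _), fun x hx => ?_, fun x hx => ?_⟩
  · rw [uc_eval_map_map, ← hq₁, ← KZ.eq_const_apply_zero x]
    exact hq x hx
  · refine (hpq hx).trans ?_
    beta_reduce
    rw [uc_eval_map_map, uc_eval_map_map, ← hp₁, ← hq₁, ← KZ.eq_const_apply_zero x]

/-- Integrability on an open interval of `ℝ¹` is integrability on the interval of the line
(transport along `MeasurableEquiv.funUnique`). [folklore] -/
theorem uc_integrableOn_Ioo {f : (Fin 1 → ℝ) → ℝ} {g : ℝ → ℝ} {u v : ℝ}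
    (hf : IntegrableOn f {x : Fin 1 → ℝ | x 0 ∈ Ioo u v})
    (hfg : ∀ x : Fin 1 → ℝ, x 0 ∈ Ioo u v → f x = g (x 0)) : IntegrableOn g (Ioo u v) := by
  have hmp := MeasureTheory.volume_preserving_funUnique (Fin 1) ℝ
  have hpre : {x : Fin 1 → ℝ | x 0 ∈ Ioo u v} =
      MeasurableEquiv.funUnique (Fin 1) ℝ ⁻¹' Ioo u v := by
    ext x
    simp [MeasurableEquiv.funUnique, Fin.default_eq_zero]
  have hms : MeasurableSet {x : Fin 1 → ℝ | x 0 ∈ Ioo u v} :=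
    measurableSet_Ioo.preimage (measurable_pi_apply 0)
  have hf' : IntegrableOn (g ∘ MeasurableEquiv.funUnique (Fin 1) ℝ)
      {x : Fin 1 → ℝ | x 0 ∈ Ioo u v} :=
    hf.congr_fun (fun x hx => by
      rw [hfg x hx, Function.comp_apply]
      simp [MeasurableEquiv.funUnique, Fin.default_eq_zero]) hms
  rw [hpre] at hf'
  exact (hmp.integrableOn_comp_preimage (MeasurableEquiv.measurableEmbedding _)).1 hf'

/-- **No integrable pole at the end points.** For a KZ-rational `ρ = [(u,v), p₀/q₀]` there are
`P, Q ∈ K[X]` with `Q ≠ 0` on the CLOSED interval `[u,v]` and `ρ.integrand = P(x₀)/Q(x₀)` on the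
domain: if `p₀ = 0` take `P = 0`, `Q = 1`; otherwise integrability of `p₀/q₀` on `(u,v)` gives
`ord_a q₀ ≤ ord_a p₀` at `a = u, v` (`KZ.rootMultiplicity_le_of_integrableOn`), and the common
factor `(X − u)^{ord_u q₀} (X − v)^{ord_v q₀}` cancels point-wise on the open interval
(`uc_cancel`). [cite: ViuSos2021, §2.3] -/
theorem uc_exists_cancelled {u v : ℝ} (hu : IsAlgebraic ℚ u) (hv : IsAlgebraic ℚ v) (huv : u < v)
    (ρ : KZ.IntegralRep 1) (hdom : ρ.domain = {x | x 0 ∈ Ioo u v}) (hrat : ρ.IsRational) :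
    ∃ P Q : (algebraicClosure ℚ ℝ)[X], (∀ t ∈ Icc u v, (Q.map (algebraMap _ ℝ)).eval t ≠ 0) ∧
      EqOn ρ.integrand
        (fun x => (P.map (algebraMap _ ℝ)).eval (x 0) / (Q.map (algebraMap _ ℝ)).eval (x 0))
        ρ.domain := by
  obtain ⟨P₀, Q₀, hQ₀, hf⟩ := uc_exists_reading ρ hrat
  have hinj : Function.Injective (algebraMap (algebraicClosure ℚ ℝ) ℝ) :=
    (algebraMap (algebraicClosure ℚ ℝ) ℝ).injective
  -- `q₀ ≠ 0` on the open interval, read on the line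
  have hQt : ∀ t ∈ Ioo u v, (Q₀.map (algebraMap _ ℝ)).eval t ≠ 0 := fun t ht =>
    hQ₀ (fun _ => t) (by rw [hdom]; exact ht)
  by_cases hP : P₀ = 0
  · -- vanishing integrand
    refine ⟨0, 1, fun t _ => ?_, fun x hx => (hf hx).trans ?_⟩
    · rw [Polynomial.map_one, eval_one]
      exact one_ne_zero
    · simp [hP]
  -- `q₀ ≠ 0` (the domain is non-empty) and `p₀ ≠ 0`
  have hQ : Q₀ ≠ 0 := by
    rintro rfl
    refine hQt ((u + v) / 2) ⟨by linarith, by linarith⟩ ?_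
    rw [Polynomial.map_zero, eval_zero]
  have hPR : P₀.map (algebraMap _ ℝ) ≠ 0 := (Polynomial.map_ne_zero_iff hinj).2 hP
  have hQR : Q₀.map (algebraMap _ ℝ) ≠ 0 := (Polynomial.map_ne_zero_iff hinj).2 hQ
  -- integrability on the line forces `ord_a q₀ ≤ ord_a p₀` on `[u, v]`
  have hint : IntegrableOn
      (fun t => (P₀.map (algebraMap _ ℝ)).eval t / (Q₀.map (algebraMap _ ℝ)).eval t) (Ioo u v) :=
    uc_integrableOn_Ioo (by rw [← hdom]; exact ρ.integrableOn)
      fun x hx => hf (by rw [hdom]; exact hx)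
  have hle : ∀ a : algebraicClosure ℚ ℝ, (a : ℝ) ∈ Icc u v →
      Q₀.rootMultiplicity a ≤ P₀.rootMultiplicity a := fun a ha => by
    rw [eq_rootMultiplicity_map hinj a, eq_rootMultiplicity_map hinj a]
    exact KZ.rootMultiplicity_le_of_integrableOn hPR hQR huv ha hint
  -- cancel the end-point factors
  have huK : u ∈ algebraicClosure ℚ ℝ := mem_algebraicClosure_iff.2 hu
  have hvK : v ∈ algebraicClosure ℚ ℝ := mem_algebraicClosure_iff.2 hv
  obtain ⟨D, P₁, Q₁, hP₁, hQ₁, hQ₁u, hQ₁v⟩ :=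
    uc_cancel hQ (u := ⟨u, huK⟩) (v := ⟨v, hvK⟩) (fun h => huv.ne (congrArg Subtype.val h))
      rfl rfl
      ((pow_dvd_pow _ (hle _ (left_mem_Icc.2 huv.le))).trans (pow_rootMultiplicity_dvd P₀ _))
      ((pow_dvd_pow _ (hle _ (right_mem_Icc.2 huv.le))).trans (pow_rootMultiplicity_dvd P₀ _))
  refine ⟨P₁, Q₁, fun t ht => ?_, fun x hx => (hf hx).trans ?_⟩
  · rcases eq_endpoints_or_mem_Ioo_of_mem_Icc ht with h | h | ht'
    · rw [h]
      change (Q₁.map (algebraMap _ ℝ)).eval ((⟨u, huK⟩ : algebraicClosure ℚ ℝ) : ℝ) ≠ 0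
      rw [uc_eval_map_coe, map_ne_zero_iff _ hinj]
      exact hQ₁u
    · rw [h]
      change (Q₁.map (algebraMap _ ℝ)).eval ((⟨v, hvK⟩ : algebraicClosure ℚ ℝ) : ℝ) ≠ 0
      rw [uc_eval_map_coe, map_ne_zero_iff _ hinj]
      exact hQ₁v
    · have h := hQt t ht'
      rw [hQ₁, Polynomial.map_mul, eval_mul] at h
      exact right_ne_zero_of_mul h
  · have hx' : x 0 ∈ Ioo u v := by
      rw [hdom] at hx
      exact hx
    have hD : (D.map (algebraMap _ ℝ)).eval (x 0) ≠ 0 := by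
      have h := hQt _ hx'
      rw [hQ₁, Polynomial.map_mul, eval_mul] at h
      exact left_ne_zero_of_mul h
    beta_reduce
    rw [hP₁, hQ₁, Polynomial.map_mul, Polynomial.map_mul, eval_mul, eval_mul,
      mul_div_mul_left _ _ hD]

/-! ### The affine chart of an interval piece as ONE change of variables -/

/-- A real polynomial with algebraic coefficients is a `ℚ`-semialgebraic function of `x 0` on
every `ℚ`-semialgebraic subset of `ℝ¹`. [folklore] -/
theorem uc_isSemialgebraicFunOn_eval {W : Set (Fin 1 → ℝ)} (hW : IsSemialgebraic ℚ W)
    {T : ℝ[X]} (hT : ∀ i, IsAlgebraic ℚ (T.coeff i)) :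
    IsSemialgebraicFunOn ℚ W (fun z => T.eval (z 0)) := by
  have h : IsSemialgebraicFunOn ℚ W (fun z => ∑ i ∈ T.support, T.coeff i * (z 0) ^ i) :=
    IsSemialgebraicFunOn.fun_finsetSum _ hW fun i _ =>
      (isSemialgebraicFunOn_const_of_isAlgebraic hW (hT i)).fun_mul
        ((isSemialgebraicFunOn_apply hW 0).fun_pow i)
  refine h.congr fun z _ => ?_
  rw [Polynomial.eval_eq_sum, Polynomial.sum_def]

/-- The affine substitution on the numerator: `(c · P(a + cX))^ℝ (s) = c · P^ℝ(a + c s)`.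
[folklore] -/
theorem uc_eval_chart (P : (algebraicClosure ℚ ℝ)[X]) (a c : algebraicClosure ℚ ℝ) (s : ℝ) :
    ((C c * P.comp (C a + C c * X)).map (algebraMap _ ℝ)).eval s =
      (c : ℝ) * (P.map (algebraMap _ ℝ)).eval ((a : ℝ) + (c : ℝ) * s) := by
  simp only [Polynomial.map_mul, Polynomial.map_C, Polynomial.map_comp, Polynomial.map_add,
    Polynomial.map_X, eval_mul, eval_C, eval_comp, eval_add, eval_X,
    IntermediateField.algebraMap_apply]

/-- The affine substitution on the denominator: `(Q(a + cX))^ℝ (s) = Q^ℝ(a + c s)`.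
[folklore] -/
theorem uc_eval_chart' (Q : (algebraicClosure ℚ ℝ)[X]) (a c : algebraicClosure ℚ ℝ) (s : ℝ) :
    ((Q.comp (C a + C c * X)).map (algebraMap _ ℝ)).eval s =
      (Q.map (algebraMap _ ℝ)).eval ((a : ℝ) + (c : ℝ) * s) := by
  simp only [Polynomial.map_mul, Polynomial.map_C, Polynomial.map_comp, Polynomial.map_add,
    Polynomial.map_X, eval_mul, eval_C, eval_comp, eval_add, eval_X,
    IntermediateField.algebraMap_apply]

/-- **The unit chart.** For `ρ = [(u,v), P/Q]` (as functions of `x₀`; `P, Q ∈ K[X]`, `Q ≠ 0` on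
`[u,v]`), the honest representation `ρ' = [(0,1), p/q]` with `p = (v−u) P(u + (v−u)X)`,
`q = Q(u + (v−u)X)` (real-algebraic coefficients, `q ≠ 0` on `[0,1]`, `p/q` continuous on `[0,1]`
hence integrable) satisfies `[ρ] − [ρ'] ∈ changeOfVariablesRel ⊆ relations` by the chart
`s = (t − u)/(v − u)` (rule 2, Jacobian `1/(v − u)`). [cite: KontsevichZagier2001, §1.2] -/
theorem uc_chart {u v : ℝ} (hu : IsAlgebraic ℚ u) (hv : IsAlgebraic ℚ v) (huv : u < v)
    (ρ : KZ.IntegralRep 1) (hdom : ρ.domain = {x | x 0 ∈ Ioo u v})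
    (P Q : (algebraicClosure ℚ ℝ)[X]) (hQ : ∀ t ∈ Icc u v, (Q.map (algebraMap _ ℝ)).eval t ≠ 0)
    (hPQ : EqOn ρ.integrand
      (fun x => (P.map (algebraMap _ ℝ)).eval (x 0) / (Q.map (algebraMap _ ℝ)).eval (x 0))
      ρ.domain) :
    ∃ (p q : ℝ[X]) (ρ' : KZ.IntegralRep 1),
      (∀ n, IsAlgebraic ℚ (p.coeff n)) ∧ (∀ n, IsAlgebraic ℚ (q.coeff n)) ∧
      (∀ t ∈ Icc (0 : ℝ) 1, q.eval t ≠ 0) ∧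
      ρ'.domain = {x | x 0 ∈ Ioo (0 : ℝ) 1} ∧
      EqOn ρ'.integrand (fun x => p.eval (x 0) / q.eval (x 0)) ρ'.domain ∧
      KZ.of ρ - KZ.of ρ' ∈ KZ.relations := by
  have huK : u ∈ algebraicClosure ℚ ℝ := mem_algebraicClosure_iff.2 hu
  have hvK : v ∈ algebraicClosure ℚ ℝ := mem_algebraicClosure_iff.2 hv
  have hb0 : 0 < v - u := sub_pos.2 huv
  have hvu : v - u ≠ 0 := hb0.ne'
  have hba : IsAlgebraic ℚ (v - u) := hv.sub hu
  -- the substituted polynomials, with real-algebraic coefficients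
  obtain ⟨p, hpa, hpe⟩ : ∃ p : ℝ[X], (∀ n, IsAlgebraic ℚ (p.coeff n)) ∧
      ∀ s, p.eval s = (v - u) * (P.map (algebraMap _ ℝ)).eval (u + (v - u) * s) :=
    ⟨_, uc_isAlgebraic_coeff _, uc_eval_chart P ⟨u, huK⟩ ⟨v - u, sub_mem hvK huK⟩⟩
  obtain ⟨q, hqa, hqe⟩ : ∃ q : ℝ[X], (∀ n, IsAlgebraic ℚ (q.coeff n)) ∧
      ∀ s, q.eval s = (Q.map (algebraMap _ ℝ)).eval (u + (v - u) * s) :=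
    ⟨_, uc_isAlgebraic_coeff _, uc_eval_chart' Q ⟨u, huK⟩ ⟨v - u, sub_mem hvK huK⟩⟩
  have hmem : ∀ s ∈ Icc (0 : ℝ) 1, u + (v - u) * s ∈ Icc u v := fun s hs =>
    ⟨by nlinarith [hs.1], by nlinarith [hs.2]⟩
  have hq0 : ∀ t ∈ Icc (0 : ℝ) 1, q.eval t ≠ 0 := fun t ht => by
    rw [hqe]
    exact hQ _ (hmem t ht)
  -- the honest representation `ρ' = [(0,1), p/q]`
  have hW : IsSemialgebraic ℚ {x : Fin 1 → ℝ | x 0 ∈ Ioo (0 : ℝ) 1} :=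
    ap_isSemialgebraic_Ioo isAlgebraic_zero isAlgebraic_one
  have hsa : IsSemialgebraicFunOn ℚ {x : Fin 1 → ℝ | x 0 ∈ Ioo (0 : ℝ) 1}
      (fun x => p.eval (x 0) / q.eval (x 0)) :=
    (uc_isSemialgebraicFunOn_eval hW hpa).div (uc_isSemialgebraicFunOn_eval hW hqa)
      fun x hx => hq0 _ (Ioo_subset_Icc_self hx)
  have hc : ContinuousOn (fun t : ℝ => p.eval t / q.eval t) (Icc 0 1) :=
    p.continuous.continuousOn.div q.continuous.continuousOn hq0
  obtain ⟨ρ', hρ'd, hρ'i⟩ : ∃ ρ' : KZ.IntegralRep 1, ρ'.domain = {x | x 0 ∈ Ioo (0 : ℝ) 1} ∧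
      ρ'.integrand = fun x => p.eval (x 0) / q.eval (x 0) :=
    ⟨⟨{x | x 0 ∈ Ioo (0 : ℝ) 1}, fun x => p.eval (x 0) / q.eval (x 0), hW, hsa,
      ap_integrableOn_fin_one hc⟩, rfl, rfl⟩
  refine ⟨p, q, ρ', hpa, hqa, hq0, hρ'd, fun x _ => by rw [hρ'i], ?_⟩
  -- ONE change of variables: the chart `s = (t - u)/(v - u)`
  have himage : ρ'.domain =
      (fun y : Fin 1 → ℝ => fun _ : Fin 1 => (y 0 - u) / (v - u)) '' ρ.domain := by
    rw [hρ'd, hdom, ap_image hb0, sub_self, zero_div, div_self hvu]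
  refine KZ.changeOfVariablesRel_subset_relations
    ⟨1, ρ, ρ', fun y : Fin 1 → ℝ => fun _ : Fin 1 => (y 0 - u) / (v - u),
      fun _ => (1 / (v - u)) • ContinuousLinearMap.id ℝ (Fin 1 → ℝ),
      ap_isSemialgebraicMapOn hu hba hvu ρ.isSemialgebraic_domain,
      fun x _ => (ap_hasFDerivAt u (v - u) x).hasFDerivWithinAt,
      ap_injOn u hvu ρ.domain, himage, fun x hx => ?_, rfl⟩
  have e1 : ρ.integrand x =
      (P.map (algebraMap _ ℝ)).eval (x 0) / (Q.map (algebraMap _ ℝ)).eval (x 0) := hPQ hx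
  have e2 : u + (v - u) * ((x 0 - u) / (v - u)) = x 0 := by
    field_simp
    ring
  show ρ.integrand x = ρ'.integrand (fun _ => (x 0 - u) / (v - u)) *
    |((1 / (v - u)) • ContinuousLinearMap.id ℝ (Fin 1 → ℝ)).det|
  rw [e1, hρ'i, ap_abs_det (one_div_pos.2 hb0)]
  show _ = p.eval ((x 0 - u) / (v - u)) / q.eval ((x 0 - u) / (v - u)) * (1 / (v - u))
  rw [hpe, hqe, e2, div_mul_eq_mul_div, mul_right_comm, mul_one_div_cancel hvu, one_mul]

end DimOne

/-- **UNIT CHART OF AN INTERVAL PIECE** (stub `stub_dimOneUnitChart` of the line `Sketch` of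
`TateLifting`, i.e. the body of `DimOneUnitChart`). A KZ-rational representation
`ρ = [(u,v), p₀/q₀]` (`u < v` real algebraic, `p₀, q₀ ∈ ℚ[x₀]`, `q₀ ≠ 0` on `(u,v)`,
`p₀/q₀ ∈ L¹(u,v)`) differs by relations from a representation `ρ' = [(0,1), p/q]` with
`p, q ∈ ℝ[x]` having real-ALGEBRAIC coefficients and `q ≠ 0` on the CLOSED interval `[0,1]`:
integrability forces `ord_a q₀ ≤ ord_a p₀` at `a = u, v` (`KZ.rootMultiplicity_le_of_integrableOn`),
so the common factors `(x−u)^i (x−v)^j` cancel point-wise on the open interval, and the affine chart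
`x = u + (v−u)s` is one change of variables (rule 2). [cite: ViuSos2021, §2.3] -/
theorem tateLifting_dimOneUnitChart :
    ∀ (u v : ℝ), IsAlgebraic ℚ u → IsAlgebraic ℚ v → u < v →
      ∀ ρ : KZ.IntegralRep 1, ρ.domain = {x | x 0 ∈ Set.Ioo u v} → ρ.IsRational →
        ∃ (p q : Polynomial ℝ) (ρ' : KZ.IntegralRep 1),
          (∀ n, IsAlgebraic ℚ (p.coeff n)) ∧ (∀ n, IsAlgebraic ℚ (q.coeff n)) ∧
          (∀ t ∈ Set.Icc (0 : ℝ) 1, q.eval t ≠ 0) ∧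
          ρ'.domain = {x | x 0 ∈ Set.Ioo (0 : ℝ) 1} ∧
          Set.EqOn ρ'.integrand (fun x => p.eval (x 0) / q.eval (x 0)) ρ'.domain ∧
          KZ.of ρ - KZ.of ρ' ∈ KZ.relations := by
  intro u v hu hv huv ρ hdom hrat
  obtain ⟨P, Q, hQ, hPQ⟩ := DimOne.uc_exists_cancelled hu hv huv ρ hdom hrat
  exact DimOne.uc_chart hu hv huv ρ hdom P Q hQ hPQ

end Summit.KontsevichZagierPeriods.InverseLandau

end
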